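import Summits.QuantumFields.BalabanUV.Beta.GAN24.InsertionChainLaw

/-!
# `BalabanUV.Beta.GAN24.InsertionChainLawCoupling` — binder row G-an2-4 ∕ (CONV-C), routes R6 × R7 in NE2's operator currency, PART 120: THE LETTERS MOVE WITH THE COUPLING.
# NE2's two hypothesis bundles are STABLE under a shift of the base point inside the Neumann disc: `FreeTowerLaws D A J F r e₀ e₁ f` + `PerturbationLaws D P J κ e₂` + `‖t‖κ < 1`
# ⟹ `FreeTowerLaws (D + tP) A J F r (νe₀) ((e₁ + ‖t‖e₂)ν²) (νf)` and `PerturbationLaws (D + tP) P J (κν) (ν²e₂)`, `ν = (1 − ‖t‖κ)⁻¹` — so PART 115's insertion-chain laws hold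
# AT EVERY COUPLING of the disc: the `n`-th background-derivative of the perturbed resolvent at `t` (not only at `t = 0`) obeys the one-step law, with the same rate and constants
# multiplied by Neumann factors (unit b2b-balaban-gan24-p3, gen 51; v1)

NOT IN PRINT; OUR PROOF ([folklore] Neumann-factor algebra BY NAME over the t4-ne2-p1 lineage's `Spine/BackgroundResolventLaw` (`isUnit_det_add_smul_right`, `opNorm_mul_inv_add_smul_le`,
`opNorm_inv_add_smul_mul_le`, `perturbed_injected_law`) and `Spine/BackgroundResolventTower` (`FreeTowerLaws`, `PerturbationLaws`); PART 115 `InsertionChainLaw` BY NAME).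
HONEST FRAMING (cell contract, verbatim): «discharging `BetaPertH` makes Bałaban's UV stability UNCONDITIONAL — a real constructive-QFT result; it is NOT the continuum limit and NOT
the Clay problem.»  HONEST DEPENDENCY (verbatim): «continuum YM on T⁴ ⇐ BetaPertH ∧ nine spine estimates (0/9 proved); BetaPertH ⇐ (D1) ∧ (D4) ∧ CAP+tail; G-an2-4 gates asym, D1
and NE2/3/4.»

WHY THIS FILE.  PART 115 gives the one-step law of the Taylor coefficients of `t ↦ (D + tP)⁻¹` AT `t = 0` — the u-derivatives at the flat point, which is what (CONV-C) «at `U = 1`» asks.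
Route R6 is also the «U ≠ 1 ∕ NE3 variant» (ROUTES §2 R7 header): derivatives at a non-zero small background.  Since the perturbed resolvent at `t + s` is the resolvent of `D + tP`
perturbed by `sP`, the derivatives at `t` are PART 115's chains built on `G(t) = (D + tP)⁻¹`; all that is needed is that the five letters survive the shift `D ↦ D + tP` — they do, by the
Neumann factors NE2 already proved, with NO new estimate.  Consequence: the whole analytic family of derivative towers converges at the values' rate, uniformly on every closed sub-disc
`‖t‖ ≤ τ < κ⁻¹` (constants polynomial in `ν = (1 − τκ)⁻¹`).

WHAT THIS FILE PROVES (0 sorry, 0 `def`, nothing cited):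
* §1 two levels: `opNorm_perturbed_complement_le` (`‖(D′ + tP′)⁻¹(1 − JJᴴ)‖ ≤ νe₀`), `opNorm_F_mul_perturbed_le` ∕ `opNorm_perturbed_mul_F_le` (pairing defects `≤ νf`),
  `opNorm_P_mul_perturbed_le` ∕ `opNorm_perturbed_mul_P_le` ((H-bd) at `t`: `≤ κν`), `opNorm_perturbed_consistency_le` ((H-cons) at `t`: `≤ ν²e₂`).
* §2 along a tower: **`freeTowerLaws_at_coupling`** and **`perturbationLaws_at_coupling`** — the two bundles for the shifted free family `k ↦ D_k + tP_k`.
* §3 **`oneStepAveragedLaw_insertion_at_coupling`** ∕ **`towerLimitRate_insertion_at_coupling`**: for every order `n` and every `‖t‖κ < 1`, the `n`-th insertion chain of the PERTURBED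
  resolvent, `((D_k + tP_k)⁻¹P_k)^n(D_k + tP_k)⁻¹` (`= (−1)^n∕n! ×` the `n`-th `t`-derivative of the perturbed resolvent AT `t`), obeys the one-step averaged law with error
  `(n+1)(κν)^n(e₁ + ‖t‖e₂)ν² + n(κν)^{n−1}ν²e₂ + (κν)^n(νe₀ + 2νf)` and, for geometric letters, the tower limit at the values' rate `ρ`.
WHAT IT DOES NOT DO: anything outside the Neumann disc; instantiate (PART 116 ∕ 118's instances transport verbatim — King's or Bałaban's averaging — by the same two theorems).  SUPPLIER work
(junction R6 × R7 × NE2); no consumer of record; NEVER «G-an2-4 closed»; NOT (CONV-C), NOT D1, NOT `BetaPertH`, NOT continuum, NOT Clay.  Records: `HOME/b2b-balaban-gan24-p3/gen51/README.md`.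
-/

noncomputable section

open scoped BigOperators ComplexConjugate Matrix Matrix.Norms.L2Operator
open Filter Topology

namespace Summit.QuantumFields.BalabanUV.Beta.GAN24.InsertionChainLawCoupling

open Summit.QuantumFields.BalabanUV.T4Continuum
open Summit.QuantumFields.BalabanUV.T4Continuum.BackgroundResolventLaw (isUnit_det_add_smul_right isUnit_det_add_smul_left opNorm_mul_inv_add_smul_le
  opNorm_inv_add_smul_mul_le perturbed_injected_law)
open Summit.QuantumFields.BalabanUV.T4Continuum.CovariantAveragingTower (OneStepAveragedLaw TowerLimitRate)
open Summit.QuantumFields.BalabanUV.T4Continuum.BackgroundResolventTower (FreeTowerLaws PerturbationLaws)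
open Summit.QuantumFields.BalabanUV.Beta.GAN24.InsertionChainLaw (oneStepAveragedLaw_insertion towerLimitRate_insertion)

/-! ## §1 Two levels: every letter survives the shift `D ↦ D + tP` with a Neumann factor -/

section TwoLevel

variable {m n : Type*} [Fintype m] [DecidableEq m] [Fintype n] [DecidableEq n]
variable {D P : Matrix n n ℂ} {D' P' : Matrix m m ℂ} {J : Matrix m n ℂ}

omit [DecidableEq n] in
/-- complement defect at coupling `t`: `‖(D′ + tP′)⁻¹(1 − JJᴴ)‖ ≤ (1 − ‖t‖κ)⁻¹·e₀` (`(D′ + tP′)⁻¹ = ((D′ + tP′)⁻¹D′)·D′⁻¹`). [our proof] -/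
theorem opNorm_perturbed_complement_le (hD' : IsUnit D'.det) {t : ℂ} {κ e₀ : ℝ} (hP' : ‖D'⁻¹ * P'‖ ≤ κ) (ht : ‖t‖ * κ < 1)
    (h₀ : ‖D'⁻¹ * (1 - J * Jᴴ)‖ ≤ e₀) : ‖(D' + t • P')⁻¹ * (1 - J * Jᴴ)‖ ≤ (1 - ‖t‖ * κ)⁻¹ * e₀ := by
  have e : (D' + t • P')⁻¹ * (1 - J * Jᴴ) = ((D' + t • P')⁻¹ * D') * (D'⁻¹ * (1 - J * Jᴴ)) := by
    rw [Matrix.mul_assoc, ← Matrix.mul_assoc D' D'⁻¹, Matrix.mul_nonsing_inv D' hD', Matrix.one_mul]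
  rw [e]
  exact (Matrix.l2_opNorm_mul _ _).trans (mul_le_mul (opNorm_inv_add_smul_mul_le hD' hP' ht) h₀ (norm_nonneg _)
    (inv_nonneg.mpr (sub_nonneg.mpr ht.le)))

omit [Fintype m] [DecidableEq m] in
/-- right pairing defect at coupling `t`: `‖F(D + tP)⁻¹‖ ≤ f·(1 − ‖t‖κ)⁻¹`. [our proof] -/
theorem opNorm_F_mul_perturbed_le (hD : IsUnit D.det) {t : ℂ} {κ f : ℝ} (hP : ‖P * D⁻¹‖ ≤ κ) (ht : ‖t‖ * κ < 1) {F : Matrix n n ℂ}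
    (hF : ‖F * D⁻¹‖ ≤ f) : ‖F * (D + t • P)⁻¹‖ ≤ f * (1 - ‖t‖ * κ)⁻¹ := by
  have e : F * (D + t • P)⁻¹ = (F * D⁻¹) * (D * (D + t • P)⁻¹) := by
    rw [Matrix.mul_assoc, ← Matrix.mul_assoc D⁻¹ D, Matrix.nonsing_inv_mul D hD, Matrix.one_mul]
  rw [e]
  exact (Matrix.l2_opNorm_mul _ _).trans (mul_le_mul hF (opNorm_mul_inv_add_smul_le hD hP ht) (norm_nonneg _) ((norm_nonneg _).trans hF))

omit [Fintype m] [DecidableEq m] in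
/-- left pairing defect at coupling `t`: `‖(D + tP)⁻¹Fᴴ‖ ≤ (1 − ‖t‖κ)⁻¹·f`. [our proof] -/
theorem opNorm_perturbed_mul_F_le (hD : IsUnit D.det) {t : ℂ} {κ f : ℝ} (hPl : ‖D⁻¹ * P‖ ≤ κ) (ht : ‖t‖ * κ < 1) {F : Matrix n n ℂ}
    (hF' : ‖D⁻¹ * Fᴴ‖ ≤ f) : ‖(D + t • P)⁻¹ * Fᴴ‖ ≤ (1 - ‖t‖ * κ)⁻¹ * f := by
  have e : (D + t • P)⁻¹ * Fᴴ = ((D + t • P)⁻¹ * D) * (D⁻¹ * Fᴴ) := by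
    rw [Matrix.mul_assoc, ← Matrix.mul_assoc D D⁻¹, Matrix.mul_nonsing_inv D hD, Matrix.one_mul]
  rw [e]
  exact (Matrix.l2_opNorm_mul _ _).trans (mul_le_mul (opNorm_inv_add_smul_mul_le hD hPl ht) hF' (norm_nonneg _)
    (inv_nonneg.mpr (sub_nonneg.mpr ht.le)))

omit [Fintype m] [DecidableEq m] in
/-- (H-bd) at coupling `t`, right: `‖P(D + tP)⁻¹‖ ≤ κ·(1 − ‖t‖κ)⁻¹`. [our proof] -/
theorem opNorm_P_mul_perturbed_le (hD : IsUnit D.det) {t : ℂ} {κ : ℝ} (hP : ‖P * D⁻¹‖ ≤ κ) (ht : ‖t‖ * κ < 1) :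
    ‖P * (D + t • P)⁻¹‖ ≤ κ * (1 - ‖t‖ * κ)⁻¹ := by
  have e : P * (D + t • P)⁻¹ = (P * D⁻¹) * (D * (D + t • P)⁻¹) := by
    rw [Matrix.mul_assoc, ← Matrix.mul_assoc D⁻¹ D, Matrix.nonsing_inv_mul D hD, Matrix.one_mul]
  rw [e]
  exact (Matrix.l2_opNorm_mul _ _).trans (mul_le_mul hP (opNorm_mul_inv_add_smul_le hD hP ht) (norm_nonneg _) ((norm_nonneg _).trans hP))

omit [Fintype m] [DecidableEq m] in
/-- (H-bd) at coupling `t`, left: `‖(D + tP)⁻¹P‖ ≤ (1 − ‖t‖κ)⁻¹·κ`. [our proof] -/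
theorem opNorm_perturbed_mul_P_le (hD : IsUnit D.det) {t : ℂ} {κ : ℝ} (hPl : ‖D⁻¹ * P‖ ≤ κ) (ht : ‖t‖ * κ < 1) :
    ‖(D + t • P)⁻¹ * P‖ ≤ (1 - ‖t‖ * κ)⁻¹ * κ := by
  have e : (D + t • P)⁻¹ * P = ((D + t • P)⁻¹ * D) * (D⁻¹ * P) := by
    rw [Matrix.mul_assoc, ← Matrix.mul_assoc D D⁻¹, Matrix.mul_nonsing_inv D hD, Matrix.one_mul]
  rw [e]
  exact (Matrix.l2_opNorm_mul _ _).trans (mul_le_mul (opNorm_inv_add_smul_mul_le hD hPl ht) hPl (norm_nonneg _)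
    (inv_nonneg.mpr (sub_nonneg.mpr ht.le)))

/-- (H-cons) at coupling `t`: `‖(D′ + tP′)⁻¹(P′J − JP)(D + tP)⁻¹‖ ≤ (1 − ‖t‖κ)⁻¹·e₂·(1 − ‖t‖κ)⁻¹` — the consistency defect read through the PERTURBED propagators. [our proof] -/
theorem opNorm_perturbed_consistency_le (hD : IsUnit D.det) (hD' : IsUnit D'.det) {t : ℂ} {κ e₂ : ℝ} (hP : ‖P * D⁻¹‖ ≤ κ) (hP' : ‖D'⁻¹ * P'‖ ≤ κ)
    (ht : ‖t‖ * κ < 1) (h₂ : ‖D'⁻¹ * (P' * J - J * P) * D⁻¹‖ ≤ e₂) :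
    ‖(D' + t • P')⁻¹ * (P' * J - J * P) * (D + t • P)⁻¹‖ ≤ (1 - ‖t‖ * κ)⁻¹ * e₂ * (1 - ‖t‖ * κ)⁻¹ := by
  have e : ((D' + t • P')⁻¹ * D') * (D'⁻¹ * (P' * J - J * P) * D⁻¹) * (D * (D + t • P)⁻¹)
      = (D' + t • P')⁻¹ * (P' * J - J * P) * (D + t • P)⁻¹ := by
    calc ((D' + t • P')⁻¹ * D') * (D'⁻¹ * (P' * J - J * P) * D⁻¹) * (D * (D + t • P)⁻¹)
        = (D' + t • P')⁻¹ * (D' * D'⁻¹) * (P' * J - J * P) * (D⁻¹ * D) * (D + t • P)⁻¹ := by simp only [Matrix.mul_assoc]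
      _ = (D' + t • P')⁻¹ * (P' * J - J * P) * (D + t • P)⁻¹ := by
          rw [Matrix.mul_nonsing_inv D' hD', Matrix.nonsing_inv_mul D hD, Matrix.mul_one, Matrix.mul_one]
  rw [← e]
  have hν : 0 ≤ (1 - ‖t‖ * κ)⁻¹ := inv_nonneg.mpr (sub_nonneg.mpr ht.le)
  have he₂ : 0 ≤ e₂ := (norm_nonneg _).trans h₂
  calc _ ≤ ‖(D' + t • P')⁻¹ * D' * (D'⁻¹ * (P' * J - J * P) * D⁻¹)‖ * ‖D * (D + t • P)⁻¹‖ := Matrix.l2_opNorm_mul _ _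
    _ ≤ ‖(D' + t • P')⁻¹ * D'‖ * ‖D'⁻¹ * (P' * J - J * P) * D⁻¹‖ * ‖D * (D + t • P)⁻¹‖ := mul_le_mul_of_nonneg_right (Matrix.l2_opNorm_mul _ _) (norm_nonneg _)
    _ ≤ (1 - ‖t‖ * κ)⁻¹ * e₂ * (1 - ‖t‖ * κ)⁻¹ :=
        mul_le_mul (mul_le_mul (opNorm_inv_add_smul_mul_le hD' hP' ht) h₂ (norm_nonneg _) hν) (opNorm_mul_inv_add_smul_le hD hP ht) (norm_nonneg _)
          (mul_nonneg hν he₂)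

end TwoLevel

/-! ## §2 Along a tower: the two bundles at coupling `t` -/

section Tower

variable {ι : ℕ → Type*} [∀ k, Fintype (ι k)] [∀ k, DecidableEq (ι k)]
variable {D P : (k : ℕ) → Matrix (ι k) (ι k) ℂ} {A : (k : ℕ) → Matrix (ι k) (ι (k + 1)) ℂ}
  {J : (k : ℕ) → Matrix (ι (k + 1)) (ι k) ℂ} {F : (k : ℕ) → Matrix (ι k) (ι k) ℂ} {r κ : ℝ} {e₀ e₁ e₂ f : ℕ → ℝ}

/-- **`freeTowerLaws_at_coupling` — THE FREE BUNDLE SURVIVES THE SHIFT `D_k ↦ D_k + tP_k`** [our proof]: with `ν = (1 − ‖t‖κ)⁻¹`,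
`FreeTowerLaws (k ↦ D_k + tP_k) A J F r (ν·e₀) ((e₁ + ‖t‖e₂)·ν²) (ν·f)` — invertibility, complement, injected (NE2's `perturbed_injected_law`) and pairing defects at coupling `t`. -/
theorem freeTowerLaws_at_coupling (hfree : FreeTowerLaws D A J F r e₀ e₁ f) (hpert : PerturbationLaws D P J κ e₂) {t : ℂ} (ht : ‖t‖ * κ < 1) :
    FreeTowerLaws (fun k => D k + t • P k) A J F r (fun k => (1 - ‖t‖ * κ)⁻¹ * e₀ k) (fun k => (e₁ k + ‖t‖ * e₂ k) * ((1 - ‖t‖ * κ)⁻¹) ^ 2)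
      (fun k => f k * (1 - ‖t‖ * κ)⁻¹) where
  isUnit_det := fun k => isUnit_det_add_smul_right (hfree.isUnit_det k) (hpert.opNorm_P_mul_inv_le k) ht
  opNorm_A_sq_le := hfree.opNorm_A_sq_le
  opNorm_J_le := hfree.opNorm_J_le
  A_mul_J := hfree.A_mul_J
  opNorm_F_mul_inv_le := fun k => opNorm_F_mul_perturbed_le (hfree.isUnit_det k) (hpert.opNorm_P_mul_inv_le k) ht (hfree.opNorm_F_mul_inv_le k)
  opNorm_inv_mul_F_le := fun k => by
    rw [mul_comm]
    exact opNorm_perturbed_mul_F_le (hfree.isUnit_det k) (hpert.opNorm_inv_mul_P_le k) ht (hfree.opNorm_inv_mul_F_le k)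
  complement_le := fun k =>
    opNorm_perturbed_complement_le (hfree.isUnit_det (k + 1)) (hpert.opNorm_inv_mul_P_le (k + 1)) ht (hfree.complement_le k)
  injected_le := fun k => perturbed_injected_law (hfree.isUnit_det k) (hfree.isUnit_det (k + 1)) (hpert.opNorm_P_mul_inv_le k)
    (hpert.opNorm_inv_mul_P_le (k + 1)) ht (hfree.injected_le k) (hpert.consistent_le k)

/-- **`perturbationLaws_at_coupling` — THE PERTURBATION BUNDLE SURVIVES THE SHIFT** [our proof]: `PerturbationLaws (k ↦ D_k + tP_k) P J (κν) (ν²·e₂)`, `ν = (1 − ‖t‖κ)⁻¹`. -/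
theorem perturbationLaws_at_coupling (hfree : FreeTowerLaws D A J F r e₀ e₁ f) (hpert : PerturbationLaws D P J κ e₂) {t : ℂ} (ht : ‖t‖ * κ < 1) :
    PerturbationLaws (fun k => D k + t • P k) P J (κ * (1 - ‖t‖ * κ)⁻¹) (fun k => ((1 - ‖t‖ * κ)⁻¹) ^ 2 * e₂ k) where
  opNorm_P_mul_inv_le := fun k => opNorm_P_mul_perturbed_le (hfree.isUnit_det k) (hpert.opNorm_P_mul_inv_le k) ht
  opNorm_inv_mul_P_le := fun k => by
    rw [mul_comm]
    exact opNorm_perturbed_mul_P_le (hfree.isUnit_det k) (hpert.opNorm_inv_mul_P_le k) ht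
  consistent_le := fun k => by
    have h := opNorm_perturbed_consistency_le (J := J k) (hfree.isUnit_det k) (hfree.isUnit_det (k + 1)) (hpert.opNorm_P_mul_inv_le k)
      (hpert.opNorm_inv_mul_P_le (k + 1)) ht (hpert.consistent_le k)
    calc _ ≤ (1 - ‖t‖ * κ)⁻¹ * e₂ k * (1 - ‖t‖ * κ)⁻¹ := h
      _ = ((1 - ‖t‖ * κ)⁻¹) ^ 2 * e₂ k := by ring

/-! ## §3 The insertion chains of the PERTURBED resolvent: every order, every coupling of the disc -/

/-- **`oneStepAveragedLaw_insertion_at_coupling`** [our proof]: for every order `n` and every coupling `‖t‖κ < 1`, the `n`-th insertion chain of the perturbed resolvent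
`((D_k + tP_k)⁻¹P_k)^n(D_k + tP_k)⁻¹` obeys the one-step averaged law with error `(n+1)(κν)^n·(e₁ + ‖t‖e₂)ν² + n(κν)^{n−1}·ν²e₂ + (κν)^n·(νe₀ + 2fν)` (`ν = (1 − ‖t‖κ)⁻¹`):
PART 115 `oneStepAveragedLaw_insertion` on the shifted bundles of §2. -/
theorem oneStepAveragedLaw_insertion_at_coupling (hr : 0 < r) (hfree : FreeTowerLaws D A J F r e₀ e₁ f) (hpert : PerturbationLaws D P J κ e₂) {t : ℂ}
    (ht : ‖t‖ * κ < 1) (n : ℕ) :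
    OneStepAveragedLaw A r (fun k => ((D k + t • P k)⁻¹ * P k) ^ n * (D k + t • P k)⁻¹)
      (fun k => ((n + 1) * (κ * (1 - ‖t‖ * κ)⁻¹) ^ n * ((e₁ k + ‖t‖ * e₂ k) * ((1 - ‖t‖ * κ)⁻¹) ^ 2)
          + n * (κ * (1 - ‖t‖ * κ)⁻¹) ^ (n - 1) * (((1 - ‖t‖ * κ)⁻¹) ^ 2 * e₂ k))
        + (κ * (1 - ‖t‖ * κ)⁻¹) ^ n * ((1 - ‖t‖ * κ)⁻¹ * e₀ k + 2 * (f k * (1 - ‖t‖ * κ)⁻¹))) :=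
  oneStepAveragedLaw_insertion hr (freeTowerLaws_at_coupling hfree hpert ht) (perturbationLaws_at_coupling hfree hpert ht) n

/-- **`towerLimitRate_insertion_at_coupling`** [our proof]: geometric letters (`e₀, e₁, f ≤ C·ρ^k`, `e₂ ≤ C₂ρ^k`), `ρ < 1`, `r > 0`, `‖t‖κ < 1` ⟹ for every order `n` the unit-lattice images of the
`n`-th insertion chain of the PERTURBED resolvent converge at the values' rate `ρ`:
`TowerLimitRate A r (k ↦ ((D_k + tP_k)⁻¹P_k)^n(D_k + tP_k)⁻¹) ((n+1)(κν)^n(C₁ + ‖t‖C₂)ν² + n(κν)^{n−1}ν²C₂ + (κν)^n(νC₀ + 2νC_f)) ρ`. -/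
theorem towerLimitRate_insertion_at_coupling (hr : 0 < r) (hfree : FreeTowerLaws D A J F r e₀ e₁ f) (hpert : PerturbationLaws D P J κ e₂)
    {ρ C₀ C₁ C₂ Cf : ℝ} (hρ1 : ρ < 1) (h₀ : ∀ k, e₀ k ≤ C₀ * ρ ^ k) (h₁ : ∀ k, e₁ k ≤ C₁ * ρ ^ k) (h₂ : ∀ k, e₂ k ≤ C₂ * ρ ^ k)
    (hf : ∀ k, f k ≤ Cf * ρ ^ k) {t : ℂ} (ht : ‖t‖ * κ < 1) (n : ℕ) :
    TowerLimitRate A r (fun k => ((D k + t • P k)⁻¹ * P k) ^ n * (D k + t • P k)⁻¹)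
      (((n + 1) * (κ * (1 - ‖t‖ * κ)⁻¹) ^ n * ((C₁ + ‖t‖ * C₂) * ((1 - ‖t‖ * κ)⁻¹) ^ 2)
          + n * (κ * (1 - ‖t‖ * κ)⁻¹) ^ (n - 1) * (((1 - ‖t‖ * κ)⁻¹) ^ 2 * C₂))
        + (κ * (1 - ‖t‖ * κ)⁻¹) ^ n * ((1 - ‖t‖ * κ)⁻¹ * C₀ + 2 * (Cf * (1 - ‖t‖ * κ)⁻¹))) ρ := by
  have hν : 0 ≤ (1 - ‖t‖ * κ)⁻¹ := inv_nonneg.mpr (sub_nonneg.mpr ht.le)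
  refine towerLimitRate_insertion hr (freeTowerLaws_at_coupling hfree hpert ht) (perturbationLaws_at_coupling hfree hpert ht) hρ1
    (fun k => ?_) (fun k => ?_) (fun k => ?_) (fun k => ?_) n
  · calc (1 - ‖t‖ * κ)⁻¹ * e₀ k ≤ (1 - ‖t‖ * κ)⁻¹ * (C₀ * ρ ^ k) := mul_le_mul_of_nonneg_left (h₀ k) hν
      _ = (1 - ‖t‖ * κ)⁻¹ * C₀ * ρ ^ k := by ring
  · have hsum : e₁ k + ‖t‖ * e₂ k ≤ (C₁ + ‖t‖ * C₂) * ρ ^ k := by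
      have := mul_le_mul_of_nonneg_left (h₂ k) (norm_nonneg t)
      nlinarith [h₁ k]
    calc (e₁ k + ‖t‖ * e₂ k) * ((1 - ‖t‖ * κ)⁻¹) ^ 2 ≤ ((C₁ + ‖t‖ * C₂) * ρ ^ k) * ((1 - ‖t‖ * κ)⁻¹) ^ 2 :=
          mul_le_mul_of_nonneg_right hsum (pow_nonneg hν 2)
      _ = (C₁ + ‖t‖ * C₂) * ((1 - ‖t‖ * κ)⁻¹) ^ 2 * ρ ^ k := by ring
  · calc ((1 - ‖t‖ * κ)⁻¹) ^ 2 * e₂ k ≤ ((1 - ‖t‖ * κ)⁻¹) ^ 2 * (C₂ * ρ ^ k) := mul_le_mul_of_nonneg_left (h₂ k) (pow_nonneg hν 2)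
      _ = ((1 - ‖t‖ * κ)⁻¹) ^ 2 * C₂ * ρ ^ k := by ring
  · calc f k * (1 - ‖t‖ * κ)⁻¹ ≤ (Cf * ρ ^ k) * (1 - ‖t‖ * κ)⁻¹ := mul_le_mul_of_nonneg_right (hf k) hν
      _ = Cf * (1 - ‖t‖ * κ)⁻¹ * ρ ^ k := by ring

end Tower

end Summit.QuantumFields.BalabanUV.Beta.GAN24.InsertionChainLawCoupling

end
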